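import Mathlib
import Summits.Ventures.PercRepro2.TB14Series

/-!
# The parallel rule and the loop rule for typed BHK 1.4
(blind cell PercRepro2, mine-c g16, 2026-08-25; `proofs/MINEC-TB14BLOCK.md` Theorem E, §9)

Two parallel free edges `e, e′` (same ends): of the four colourings of the pair, the two
monochromatic ones are the two colourings of the single free edge `e` with `e′` deleted, and the
two mixed ones both give the pair open in BOTH copies — the profile with `e` pinned open and `e′`
deleted.  Hence (`pairCount_foldK_parallel`)

  `D(F, z) = D(F − e′, z[e′ ↦ 0]) + 2 · D(F − e − e′, z[e′ ↦ 0][e ↦ 1])`.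

A free loop `e` is invisible in either colour (`pairCount_foldK_loop`):
`D(F, z) = 2 · D(F − e, z[e ↦ 0])`.  Together with the profile reduction (`TB14Profile`: the
pinned-open `e` is contracted) these reduce the all-free core of row 2′TB to SIMPLE graphs.
Own work; standard axioms.
-/

namespace Summit.Ventures.PercRepro2

namespace TB14Cut

open CovForm A3InactiveTyped

/-! ## Connectivity: a parallel edge, a loop -/

section Conn

variable {V : Type*} {E : Type*} [DecidableEq E]

/-- Changing the status of an edge `e′` parallel to an OPEN edge `e ≠ e′` does not change any
connection. -/
lemma conn_update_parallel {ends : E → Sym2 V} {y : Config E} {e e' : E} (hne : e ≠ e')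
    (hpar : ends e' = ends e) (he : y e = true) (c : Bool) (x x' : V) :
    Conn ends (Function.update y e' c) x x' ↔ Conn ends y x x' := by
  have hstep : ∀ (y₁ y₂ : Config E), y₂ e = true →
      (∀ f, f ≠ e' → y₁ f = y₂ f) → Conn ends y₁ x x' → Conn ends y₂ x x' := by
    intro y₁ y₂ h₂ hagree h
    refine mem_of_conn_of_closed (S := {t | Conn ends y₂ x t}) ?_ (conn_refl _ _ x) h
    intro a ha w haw
    obtain ⟨_, f, hf, hends⟩ := openGraph_adj.1 haw
    by_cases hfe : f = e'
    · subst hfe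
      rw [hpar] at hends
      exact conn_trans ha (conn_of_openAdj ⟨e, h₂, hends⟩)
    · rw [hagree f hfe] at hf
      exact conn_trans ha (conn_of_openAdj ⟨f, hf, hends⟩)
  have hue : Function.update y e' c e = true := by rw [Function.update_of_ne hne]; exact he
  constructor
  · exact hstep _ _ he (fun f hf => Function.update_of_ne hf _ _)
  · exact hstep _ _ hue (fun f hf => (Function.update_of_ne hf _ _).symm)

/-- Opening either edge of a parallel pair gives the same connections. -/
lemma conn_update_parallel_swap {ends : E → Sym2 V} {y : Config E} {e e' : E} (hne : e ≠ e')
    (hpar : ends e' = ends e) (x x' : V) :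
    Conn ends (Function.update y e' true) x x' ↔ Conn ends (Function.update y e true) x x' := by
  have h1 : Conn ends (Function.update (Function.update y e' true) e true) x x' ↔
      Conn ends (Function.update y e' true) x x' :=
    conn_update_parallel hne.symm hpar.symm (by rw [Function.update_self]) true x x'
  have h2 : Conn ends (Function.update (Function.update y e true) e' true) x x' ↔
      Conn ends (Function.update y e true) x x' :=
    conn_update_parallel hne hpar (by rw [Function.update_self]) true x x'
  rw [← h1, Function.update_comm hne.symm, h2]

/-- Changing the status of a loop does not change any connection. -/
lemma conn_update_loop {ends : E → Sym2 V} {y : Config E} {e : E} (hl : (ends e).IsDiag)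
    (c : Bool) (x x' : V) :
    Conn ends (Function.update y e c) x x' ↔ Conn ends y x x' := by
  have hstep : ∀ (y₁ y₂ : Config E), (∀ f, f ≠ e → y₁ f = y₂ f) →
      Conn ends y₁ x x' → Conn ends y₂ x x' := by
    intro y₁ y₂ hagree h
    refine mem_of_conn_of_closed (S := {t | Conn ends y₂ x t}) ?_ (conn_refl _ _ x) h
    intro a ha w haw
    obtain ⟨hne, f, hf, hends⟩ := openGraph_adj.1 haw
    by_cases hfe : f = e
    · subst hfe
      rw [hends, Sym2.mk_isDiag_iff] at hl
      exact absurd hl hne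
    · rw [hagree f hfe] at hf
      exact conn_trans ha (conn_of_openAdj ⟨f, hf, hends⟩)
  constructor
  · exact hstep _ _ (fun f hf => Function.update_of_ne hf _ _)
  · exact hstep _ _ (fun f hf => (Function.update_of_ne hf _ _).symm)

end Conn

/-! ## Bookkeeping: re-indexing by a pinned edge, `flipOn` and updates -/

section Reindex

variable {E : Type*} [Fintype E] [DecidableEq E] {R : Type*} [CommRing R]

/-- The admissible configurations of `(F, z[e ↦ c])` are the admissible configurations of
`(F, z)` with `e` set to `c` (for `e ∉ F`). -/
lemma sum_admissible_update {F : Finset E} {z : Config E} {e : E} (he : e ∉ F) (c : Bool)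
    (g : Config E → R) :
    (∑ y : Config E, if (∀ f, f ∉ F → y f = Function.update z e c f) then g y else 0) =
      ∑ y : Config E, if (∀ f, f ∉ F → y f = z f) then g (Function.update y e c) else 0 := by
  rw [← Finset.sum_filter, ← Finset.sum_filter]
  refine Finset.sum_nbij' (fun y => Function.update y e (z e)) (fun y => Function.update y e c)
    ?_ ?_ ?_ ?_ ?_
  · intro y hy
    rw [Finset.mem_filter] at hy ⊢
    refine ⟨Finset.mem_univ _, fun f hf => ?_⟩
    by_cases hfe : f = e
    · subst hfe; rw [Function.update_self]
    · rw [Function.update_of_ne hfe, hy.2 f hf, Function.update_of_ne hfe]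
  · intro y hy
    rw [Finset.mem_filter] at hy ⊢
    refine ⟨Finset.mem_univ _, fun f hf => ?_⟩
    by_cases hfe : f = e
    · subst hfe; rw [Function.update_self, Function.update_self]
    · rw [Function.update_of_ne hfe, hy.2 f hf, Function.update_of_ne hfe]
  · intro y hy
    rw [Finset.mem_filter] at hy
    have hye : y e = c := by
      have := hy.2 e he
      rwa [Function.update_self] at this
    rw [Function.update_idem, ← hye, Function.update_eq_self]
  · intro y hy
    rw [Finset.mem_filter] at hy
    have hye : y e = z e := hy.2 e he
    rw [Function.update_idem, ← hye, Function.update_eq_self]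
  · intro y hy
    rw [Finset.mem_filter] at hy
    have hye : y e = c := by
      have := hy.2 e he
      rwa [Function.update_self] at this
    rw [Function.update_idem, ← hye, Function.update_eq_self]

omit [Fintype E] in
/-- `flipOn` commutes with an update at an edge outside the free set. -/
lemma flipOn_update_of_notMem {F : Finset E} {e : E} (he : e ∉ F) (y : Config E) (c : Bool) :
    A3InactiveTyped.flipOn F (Function.update y e c) =
      Function.update (A3InactiveTyped.flipOn F y) e c := by
  funext f
  by_cases hfe : f = e
  · subst hfe
    rw [Function.update_self, A3InactiveTyped.flipOn_of_notMem he, Function.update_self]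
  · rw [Function.update_of_ne hfe]
    by_cases hfF : f ∈ F
    · rw [A3InactiveTyped.flipOn_of_mem hfF, A3InactiveTyped.flipOn_of_mem hfF,
        Function.update_of_ne hfe]
    · rw [A3InactiveTyped.flipOn_of_notMem hfF, A3InactiveTyped.flipOn_of_notMem hfF,
        Function.update_of_ne hfe]

omit [Fintype E] in
/-- `flipOn F` after an update at an edge of `F`: the update is negated, the rest is
`flipOn (F.erase e)`. -/
lemma flipOn_update_of_mem {F : Finset E} {e : E} (he : e ∈ F) (y : Config E) (c : Bool) :
    A3InactiveTyped.flipOn F (Function.update y e c) =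
      Function.update (A3InactiveTyped.flipOn (F.erase e) y) e (!c) := by
  funext f
  by_cases hfe : f = e
  · subst hfe
    rw [A3InactiveTyped.flipOn_of_mem he, Function.update_self, Function.update_self]
  · rw [Function.update_of_ne hfe]
    by_cases hfF : f ∈ F
    · rw [A3InactiveTyped.flipOn_of_mem hfF,
        A3InactiveTyped.flipOn_of_mem (Finset.mem_erase.2 ⟨hfe, hfF⟩), Function.update_of_ne hfe]
    · rw [A3InactiveTyped.flipOn_of_notMem hfF,
        A3InactiveTyped.flipOn_of_notMem (fun h => hfF (Finset.mem_of_mem_erase h)),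
        Function.update_of_ne hfe]

end Reindex

/-! ## The parallel rule -/

section Parallel

variable {V : Type} {E : Type} [Fintype E] [DecidableEq E] {R : Type*} [Field R]

omit [Fintype E] [DecidableEq E] in
/-- The folded kernel only depends on the connections. -/
lemma foldK_congr' {ends : E → Sym2 V} {a₁ a₂ b o : V} {y y' w₁ w₁' : Config E}
    (h1 : ∀ x x' : V, Conn ends y x x' ↔ Conn ends y' x x')
    (h2 : ∀ x x' : V, Conn ends w₁ x x' ↔ Conn ends w₁' x x') :
    (foldK ends a₁ a₂ b o y w₁ : R) = foldK ends a₁ a₂ b o y' w₁' := by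
  classical
  simp only [foldK, iQ_eq_ite', iL_eq_ite', iH_eq_ite', h1 a₁ a₂, h1 a₁ b, h1 a₂ o, h2 a₁ a₂,
    h2 a₂ o]

variable {ends : E → Sym2 V} {e e' : E}

omit [Fintype E] in
/-- **The four colourings of a parallel pair**, pointwise: with `y, w` both closed at `e, e′`
(`y` the first copy off the pair, `w` the second), the colouring `(c₁, c₂)` of `(e, e′)` gives
the kernel at `(y[e ↦ c₁][e′ ↦ c₂], w[e ↦ !c₁][e′ ↦ !c₂])`; the monochromatic ones are the two
colourings of `e` alone, the mixed ones the pinned-open instance. -/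
lemma foldK_parallel_pointwise (hne : e ≠ e') (hpar : ends e' = ends e) {a₁ a₂ b o : V}
    {y w : Config E} (hye : y e = false) (hye' : y e' = false) (hwe : w e = false)
    (hwe' : w e' = false) :
    (foldK ends a₁ a₂ b o (Function.update (Function.update y e false) e' false)
        (Function.update (Function.update w e true) e' true) : R) +
      foldK ends a₁ a₂ b o (Function.update (Function.update y e true) e' false)
        (Function.update (Function.update w e false) e' true) +
      (foldK ends a₁ a₂ b o (Function.update (Function.update y e false) e' true)
        (Function.update (Function.update w e true) e' false) +
      foldK ends a₁ a₂ b o (Function.update (Function.update y e true) e' true)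
        (Function.update (Function.update w e false) e' false)) =
    (foldK ends a₁ a₂ b o (Function.update y e false) (Function.update w e true) +
      foldK ends a₁ a₂ b o (Function.update y e true) (Function.update w e false)) +
      2 * foldK ends a₁ a₂ b o (Function.update y e true) (Function.update w e true) := by
  have hy0 : Function.update y e false = y := by rw [← hye]; exact Function.update_eq_self e y
  have hw0 : Function.update w e false = w := by rw [← hwe]; exact Function.update_eq_self e w
  have hy0' : Function.update y e' false = y := by rw [← hye']; exact Function.update_eq_self e' y
  have hw0' : Function.update w e' false = w := by rw [← hwe']; exact Function.update_eq_self e' w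
  have hyt' : Function.update (Function.update y e true) e' false = Function.update y e true := by
    rw [Function.update_comm hne, hy0']
  have hwt' : Function.update (Function.update w e true) e' false = Function.update w e true := by
    rw [Function.update_comm hne, hw0']
  -- (1) `e, e′` closed in the first copy, open in the second: `e′` deleted, `e` blue
  have t1 : (foldK ends a₁ a₂ b o (Function.update (Function.update y e false) e' false)
        (Function.update (Function.update w e true) e' true) : R) =
      foldK ends a₁ a₂ b o (Function.update y e false) (Function.update w e true) := by
    rw [hy0, hy0']
    refine foldK_congr' (fun x x' => Iff.rfl) (fun x x' => ?_)
    exact conn_update_parallel hne hpar (by rw [Function.update_self]) true x x'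
  -- (2) `e` open, `e′` closed in the first copy; the reverse in the second: the pinned-open pair
  have t2 : (foldK ends a₁ a₂ b o (Function.update (Function.update y e true) e' false)
        (Function.update (Function.update w e false) e' true) : R) =
      foldK ends a₁ a₂ b o (Function.update y e true) (Function.update w e true) := by
    rw [hyt', hw0]
    refine foldK_congr' (fun x x' => Iff.rfl) (fun x x' => ?_)
    exact conn_update_parallel_swap hne hpar x x'
  -- (3) `e` closed, `e′` open in the first copy; the reverse in the second: the pinned-open pair
  have t3 : (foldK ends a₁ a₂ b o (Function.update (Function.update y e false) e' true)
        (Function.update (Function.update w e true) e' false) : R) =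
      foldK ends a₁ a₂ b o (Function.update y e true) (Function.update w e true) := by
    rw [hy0, hwt']
    refine foldK_congr' (fun x x' => ?_) (fun x x' => Iff.rfl)
    exact conn_update_parallel_swap hne hpar x x'
  -- (4) `e, e′` open in the first copy, closed in the second: `e′` deleted, `e` red
  have t4 : (foldK ends a₁ a₂ b o (Function.update (Function.update y e true) e' true)
        (Function.update (Function.update w e false) e' false) : R) =
      foldK ends a₁ a₂ b o (Function.update y e true) (Function.update w e false) := by
    rw [hw0, hw0']
    refine foldK_congr' (fun x x' => ?_) (fun x x' => Iff.rfl)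
    exact conn_update_parallel hne hpar (by rw [Function.update_self]) true x x'
  rw [t1, t2, t3, t4]
  ring

/-- **The parallel rule** (THEOREM): for two parallel free edges `e, e′`,
`D(F, z) = D(F − e′, z[e′ ↦ 0]) + 2 · D(F − e − e′, z[e′ ↦ 0][e ↦ 1])` — the second instance
has `e` pinned open and `e′` deleted. -/
theorem pairCount_foldK_parallel (hne : e ≠ e') (hpar : ends e' = ends e) {a₁ a₂ b o : V}
    (F : Finset E) (z : Config E) (heF : e ∈ F) (he'F : e' ∈ F) :
    pairCount F z (foldK ends a₁ a₂ b o : Config E → Config E → R) =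
      pairCount (F.erase e') (Function.update z e' false) (foldK ends a₁ a₂ b o) +
        2 * pairCount ((F.erase e').erase e)
          (Function.update (Function.update z e' false) e true) (foldK ends a₁ a₂ b o) := by
  set F' := F.erase e' with hF'
  set z' := Function.update z e' false with hz'
  set F'' := F'.erase e with hF''
  set z'' := Function.update z' e false with hz''
  have heF' : e ∈ F' := Finset.mem_erase.2 ⟨hne, heF⟩
  have he'F' : e' ∉ F' := Finset.notMem_erase e' F
  have heF'' : e ∉ F'' := Finset.notMem_erase e F'
  have he'F'' : e' ∉ F'' := fun hx => he'F' (Finset.mem_of_mem_erase hx)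
  -- the second copies in terms of `w := flipOn F'' y`
  have hflip : ∀ (y : Config E) (c₁ c₂ : Bool),
      A3InactiveTyped.flipOn F (Function.update (Function.update y e c₁) e' c₂) =
        Function.update (Function.update (A3InactiveTyped.flipOn F'' y) e (!c₁)) e' (!c₂) := by
    intro y c₁ c₂
    rw [flipOn_update_of_mem he'F, ← hF', flipOn_update_of_mem heF', ← hF'']
  have hflip' : ∀ (y : Config E) (c : Bool),
      A3InactiveTyped.flipOn F' (Function.update y e c) =
        Function.update (A3InactiveTyped.flipOn F'' y) e (!c) := by
    intro y c
    rw [flipOn_update_of_mem heF', ← hF'']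
  have hflip'' : ∀ (y : Config E) (c : Bool),
      A3InactiveTyped.flipOn F'' (Function.update y e c) =
        Function.update (A3InactiveTyped.flipOn F'' y) e c := fun y c =>
    flipOn_update_of_notMem heF'' y c
  -- the counting
  unfold pairCount
  rw [sum_admissible_split he'F, ← hF', ← hz', sum_admissible_split heF', ← hF'', ← hz'']
  have hstep : ∀ y : Config E,
      (if (∀ f, f ∉ F'' → y f = z'' f) then
        (foldK ends a₁ a₂ b o (Function.update (Function.update y e false) e' false)
            (A3InactiveTyped.flipOn F (Function.update (Function.update y e false) e' false)) +
          foldK ends a₁ a₂ b o (Function.update (Function.update y e false) e' true)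
            (A3InactiveTyped.flipOn F (Function.update (Function.update y e false) e' true))) +
        (foldK ends a₁ a₂ b o (Function.update (Function.update y e true) e' false)
            (A3InactiveTyped.flipOn F (Function.update (Function.update y e true) e' false)) +
          foldK ends a₁ a₂ b o (Function.update (Function.update y e true) e' true)
            (A3InactiveTyped.flipOn F (Function.update (Function.update y e true) e' true)))
        else (0 : R)) =
      (if (∀ f, f ∉ F'' → y f = z'' f) then
        foldK ends a₁ a₂ b o (Function.update y e false)
            (A3InactiveTyped.flipOn F' (Function.update y e false)) +
          foldK ends a₁ a₂ b o (Function.update y e true)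
            (A3InactiveTyped.flipOn F' (Function.update y e true)) else 0) +
      2 * (if (∀ f, f ∉ F'' → y f = z'' f) then
        foldK ends a₁ a₂ b o (Function.update y e true)
          (A3InactiveTyped.flipOn F'' (Function.update y e true)) else 0) := by
    intro y
    by_cases hadm : ∀ f, f ∉ F'' → y f = z'' f
    · rw [if_pos hadm, if_pos hadm, if_pos hadm]
      have hye : y e = false := by
        have := hadm e heF''
        rwa [hz'', Function.update_self] at this
      have hye' : y e' = false := by
        have := hadm e' he'F''
        rwa [hz'', Function.update_of_ne hne.symm, hz', Function.update_self] at this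
      have hwe : A3InactiveTyped.flipOn F'' y e = false := by
        rw [A3InactiveTyped.flipOn_of_notMem heF'']; exact hye
      have hwe' : A3InactiveTyped.flipOn F'' y e' = false := by
        rw [A3InactiveTyped.flipOn_of_notMem he'F'']; exact hye'
      rw [hflip, hflip, hflip, hflip, hflip', hflip', hflip'']
      have key := foldK_parallel_pointwise (R := R) hne hpar (a₁ := a₁) (a₂ := a₂) (b := b)
        (o := o) hye hye' hwe hwe'
      simp only [Bool.not_false, Bool.not_true] at key ⊢
      rw [← key]
      ring
    · rw [if_neg hadm, if_neg hadm, if_neg hadm, mul_zero, add_zero]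
  simp_rw [hstep]
  rw [Finset.sum_add_distrib, ← Finset.mul_sum]
  congr 1
  · symm
    rw [sum_admissible_split heF', ← hF'', ← hz'']
  · congr 1
    have hz3 : Function.update z' e true = Function.update z'' e true := by
      rw [hz'', Function.update_idem]
    rw [hz3, sum_admissible_update heF'' true]

/-! ## The loop rule -/

omit [Fintype E] in
/-- The folded kernel at a configuration pair does not see the status of a loop. -/
lemma foldK_update_loop {a₁ a₂ b o : V} (hl : (ends e).IsDiag) (y w : Config E) (c₁ c₂ : Bool) :
    (foldK ends a₁ a₂ b o (Function.update y e c₁) (Function.update w e c₂) : R) =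
      foldK ends a₁ a₂ b o y w :=
  foldK_congr' (fun x x' => conn_update_loop hl c₁ x x') (fun x x' => conn_update_loop hl c₂ x x')

/-- **The loop rule** (THEOREM): a free loop `e` is invisible: `D(F, z) = 2 · D(F − e, z[e ↦ 0])`. -/
theorem pairCount_foldK_loop (hl : (ends e).IsDiag) {a₁ a₂ b o : V} (F : Finset E) (z : Config E)
    (heF : e ∈ F) :
    pairCount F z (foldK ends a₁ a₂ b o : Config E → Config E → R) =
      2 * pairCount (F.erase e) (Function.update z e false) (foldK ends a₁ a₂ b o) := by
  unfold pairCount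
  rw [sum_admissible_split heF, Finset.mul_sum]
  refine Finset.sum_congr rfl fun y _ => ?_
  by_cases hadm : ∀ f, f ∉ F.erase e → y f = Function.update z e false f
  · rw [if_pos hadm, if_pos hadm]
    have hye : y e = false := by
      have := hadm e (Finset.notMem_erase e F)
      rwa [Function.update_self] at this
    rw [flipOn_update_of_mem heF, flipOn_update_of_mem heF, foldK_update_loop hl,
      foldK_update_loop hl, two_mul]
  · rw [if_neg hadm, if_neg hadm, mul_zero]

end Parallel

end TB14Cut

end Summit.Ventures.PercRepro2
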